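import Literature.Computability.MetaComplexity.TseitinLiftProofs
import Literature.Computability.MetaComplexity.ResolutionTseitinProofs
import Mathlib.Data.Matrix.Mul

/-!
# PneNP / ReslinMediumCover — one-edge flips of critical assignments of `τ(G, c) ∘ MAJ₃`
(helper for stub BL of the birth skeleton of crux `ManyMediumLines`, stmt-PneNP-19698)

Route `PneNP/ReslinMediumCover`, crux `Summit.PneNP.PneNP.Theses.ReslinMediumCover.ManyMediumLines`
(open problem; NOT claimed). Bookkeeping for the boundary law
(`ReslinMediumCoverManyMediumLinesBoundaryLaw.lean`):

* the block structure of the `3N²` variable slots (three slots `liftVar e i` per edge `e`; they are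
  `< 3N²` and pairwise distinct: `liftVar_lt`, `liftVar_inj`, `pad_liftVar`);
* `MAJ₃` is 1-STIFLING (`gadgetMaj3_eq_of_two`: two equal inputs force the output);
* ONE EDGE FLIP MOVES A CRITICAL ASSIGNMENT ALONG THE EDGE (`critAt_of_flip_edge`): if `x` is
  `v`-critical and `x'` has the same lifted edge values except that the value of the edge `{v, v'}`
  is flipped, then `x'` is `v'`-critical (the lifted form of the step "flip `x_e` for a boundary edge"
  in the Ben-Sasson–Wigderson / Urquhart argument, Jukna 2012 Thm 18.17);
* parity bookkeeping `card_filter_pad_eq_dotProduct` (number of true variables of a form under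
  `pad x`, mod 2, as a dot product over `𝔽₂` on the slots).

References: S. Jukna, *Boolean Function Complexity* (2012), §18.7, Thm 18.17; A. Urquhart, J. ACM 34
(1987) §4; S. K. Bhattacharya, F. Byramji, A. Chattopadhyay, R. Impagliazzo, STOC 2026, Thm 1.2
(`τ(G, c) ∘ MAJ₃`, 1-stifling gadgets).
-/

namespace Summit.PneNP.PneNP.Theorems

-- `Summit.PneNP.PneNP` repeats a path component by design (summit = sub-problem); silence the linter.
set_option linter.dupNamespace false

namespace ResLinBoundaryLaw

open Finset Literature.Computability.Complexity Literature.Computability.MetaComplexity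

variable {N : ℕ}

/-! ### The block structure: three slots per edge -/

/-- The edge numbering is below `N²`. -/
theorem tseitinEdgeVar_lt (e : Sym2 (Fin N)) : tseitinEdgeVar e < N ^ 2 := by
  unfold tseitinEdgeVar
  have h1 : (e.inf : ℕ) ≤ N - 1 := Nat.le_sub_one_of_lt e.inf.isLt
  have h2 : (e.sup : ℕ) < N := e.sup.isLt
  have hN : 1 ≤ N := Nat.one_le_of_lt e.sup.isLt
  calc (e.inf : ℕ) * N + (e.sup : ℕ) < (N - 1) * N + N := by
        have := Nat.mul_le_mul_right N h1
        omega
    _ = N ^ 2 := by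
        rcases Nat.exists_eq_succ_of_ne_zero (by omega : N ≠ 0) with ⟨m, rfl⟩
        simp [pow_two, Nat.succ_mul, Nat.mul_succ]

/-- The lifted slots are below `3 N²`. -/
theorem liftVar_lt (e : Sym2 (Fin N)) {i : ℕ} (hi : i < 3) : liftVar e i < 3 * N ^ 2 := by
  unfold liftVar
  have := tseitinEdgeVar_lt e
  omega

/-- Distinct (edge, position) pairs have distinct lifted slots. -/
theorem liftVar_inj {e e' : Sym2 (Fin N)} {i i' : ℕ} (hi : i < 3) (hi' : i' < 3)
    (h : liftVar e i = liftVar e' i') : e = e' ∧ i = i' := by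
  unfold liftVar at h
  have ht : tseitinEdgeVar e = tseitinEdgeVar e' := by omega
  exact ⟨tseitinEdgeVar_injective ht, by omega⟩

/-- `pad x` reads slot `liftVar e i` (`i < 3`) off `x`. -/
theorem pad_liftVar (x : Fin (3 * N ^ 2) → Bool) (e : Sym2 (Fin N)) {i : ℕ} (hi : i < 3) :
    pad x (liftVar e i) = x ⟨liftVar e i, liftVar_lt e hi⟩ := by
  unfold pad
  rw [dif_pos (liftVar_lt e hi)]

/-- `MAJ₃` is 1-stifling: if the two positions other than `p` carry the bit `t`, the output is `t`.
[Bhattacharya–Byramji–Chattopadhyay–Impagliazzo 2026, Thm 1.2 (the 3-bit majority is 1-stifling)] -/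
theorem gadgetMaj3_eq_of_two (a₀ a₁ a₂ t : Bool) (p : Fin 3) (h₀ : p ≠ 0 → a₀ = t)
    (h₁ : p ≠ 1 → a₁ = t) (h₂ : p ≠ 2 → a₂ = t) : gadgetMaj3 a₀ a₁ a₂ = t := by
  fin_cases p
  · rw [h₁ (by decide), h₂ (by decide)]
    cases a₀ <;> cases t <;> rfl
  · rw [h₀ (by decide), h₂ (by decide)]
    cases a₁ <;> cases t <;> rfl
  · rw [h₀ (by decide), h₁ (by decide)]
    cases a₂ <;> cases t <;> rfl

/-! ### Flipping one edge at a critical assignment -/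

variable (G : SimpleGraph (Fin N)) [DecidableRel G.Adj] (c : Fin N → Bool)

/-- The lifted parity constraint of `u` only reads the lifted values of the edges at `u`. -/
theorem vertexOK_congr_edgeVal {σ σ' : ℕ → Bool} (u : Fin N)
    (h : ∀ w, G.Adj u w → edgeVal σ' s(u, w) = edgeVal σ s(u, w)) :
    vertexOK G c σ' u = vertexOK G c σ u := by
  unfold vertexOK
  rw [Finset.filter_congr (fun w hw => by
    rw [h w ((SimpleGraph.mem_neighborFinset G u w).mp hw)])]

/-- Flipping the lifted value of exactly one edge `{u, w₀}` at `u` flips the parity constraint of `u`. -/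
theorem vertexOK_flip {σ σ' : ℕ → Bool} {u w₀ : Fin N} (hadj : G.Adj u w₀)
    (hflip : edgeVal σ' s(u, w₀) = !edgeVal σ s(u, w₀))
    (hkeep : ∀ w, G.Adj u w → w ≠ w₀ → edgeVal σ' s(u, w) = edgeVal σ s(u, w)) :
    vertexOK G c σ' u = !vertexOK G c σ u := by
  classical
  -- the common part of the two filters
  set F₀ : Finset (Fin N) :=
    (G.neighborFinset u).filter fun w => w ≠ w₀ ∧ edgeVal σ s(u, w) = true with hF₀
  have hw₀F₀ : w₀ ∉ F₀ := by simp [hF₀]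
  have hw₀ : w₀ ∈ G.neighborFinset u := (SimpleGraph.mem_neighborFinset G u w₀).mpr hadj
  have hsplit : ∀ (τ : ℕ → Bool), (∀ w, G.Adj u w → w ≠ w₀ → edgeVal τ s(u, w) = edgeVal σ s(u, w)) →
      ((G.neighborFinset u).filter fun w => edgeVal τ s(u, w) = true) =
        if edgeVal τ s(u, w₀) = true then insert w₀ F₀ else F₀ := by
    intro τ hτ
    ext w
    simp only [Finset.mem_filter, SimpleGraph.mem_neighborFinset, hF₀]
    by_cases hw : w = w₀
    · subst hw
      by_cases hv : edgeVal τ s(u, w) = true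
      · simp [hv, hadj]
      · simp [hv]
    · by_cases hv : edgeVal τ s(u, w₀) = true
      · rw [if_pos hv, Finset.mem_insert, Finset.mem_filter, SimpleGraph.mem_neighborFinset]
        constructor
        · rintro ⟨ha, ht⟩
          exact Or.inr ⟨ha, hw, by rw [← hτ w ha hw]; exact ht⟩
        · rintro (rfl | ⟨ha, -, ht⟩)
          · exact absurd rfl hw
          · exact ⟨ha, by rw [hτ w ha hw]; exact ht⟩
      · rw [if_neg hv, Finset.mem_filter, SimpleGraph.mem_neighborFinset]
        constructor
        · rintro ⟨ha, ht⟩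
          exact ⟨ha, hw, by rw [← hτ w ha hw]; exact ht⟩
        · rintro ⟨ha, -, ht⟩
          exact ⟨ha, by rw [hτ w ha hw]; exact ht⟩
  have hσ := hsplit σ (fun w _ _ => rfl)
  have hσ' := hsplit σ' hkeep
  have hcu : (c u).toNat < 2 := by cases c u <;> simp
  unfold vertexOK
  rw [hσ, hσ']
  rw [hflip]
  cases hval : edgeVal σ s(u, w₀)
  · simp only [Bool.not_false, ↓reduceIte, Bool.false_eq_true, Finset.card_insert_of_notMem hw₀F₀]
    rcases Nat.mod_two_eq_zero_or_one F₀.card with h | h <;>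
      · by_cases hc : c u = true <;> simp [hc, h, Nat.add_mod]
  · simp only [Bool.not_true, Bool.false_eq_true, ↓reduceIte, Finset.card_insert_of_notMem hw₀F₀]
    rcases Nat.mod_two_eq_zero_or_one F₀.card with h | h <;>
      · by_cases hc : c u = true <;> simp [hc, h, Nat.add_mod]

/-- **One edge flip moves a critical assignment along the edge**: if `x` is `v`-critical, `{v, v'}`
is an edge, and `x'` has the same lifted edge values as `x` except that the value of `{v, v'}` is
flipped, then `x'` is `v'`-critical. [Jukna 2012, §18.7 (proof of Thm 18.17: flipping `x_e` for a
boundary edge `e = {u, w}` turns a `u`-critical assignment into a `w`-critical one)] -/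
theorem critAt_of_flip_edge {x x' : Fin (3 * N ^ 2) → Bool} {v v' : Fin N} (hadj : G.Adj v v')
    (hx : x ∈ critAt G c v)
    (hflip : edgeVal (pad x') s(v, v') = !edgeVal (pad x) s(v, v'))
    (hkeep : ∀ e ∈ G.edgeSet, e ≠ s(v, v') → edgeVal (pad x') e = edgeVal (pad x) e) :
    x' ∈ critAt G c v' := by
  rw [mem_critAt] at hx ⊢
  have hvv' : v ≠ v' := G.ne_of_adj hadj
  have hv_old : vertexOK G c (pad x) v = false := by simpa using hx v
  have hv'_old : vertexOK G c (pad x) v' = true := (hx v').mpr hvv'.symm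
  have hv_new : vertexOK G c (pad x') v = true := by
    rw [vertexOK_flip G c hadj hflip ?_, hv_old]
    · rfl
    · intro u hu hne
      exact hkeep _ ((SimpleGraph.mem_edgeSet G).mpr hu) (fun h => hne (Sym2.congr_right.mp h))
  have hv'_new : vertexOK G c (pad x') v' = false := by
    have hflip' : edgeVal (pad x') s(v', v) = !edgeVal (pad x) s(v', v) := by
      rw [Sym2.eq_swap]
      exact hflip
    rw [vertexOK_flip G c hadj.symm hflip' ?_, hv'_old]
    · rfl
    · intro u hu hne
      refine hkeep _ ((SimpleGraph.mem_edgeSet G).mpr hu) (fun h => hne ?_)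
      rcases Sym2.eq_iff.mp h with ⟨h1, -⟩ | ⟨-, h2⟩
      · exact absurd h1.symm hvv'
      · exact h2
  intro w
  by_cases hwv : w = v
  · rw [hwv, hv_new]
    exact ⟨fun _ => hvv', fun _ => rfl⟩
  by_cases hwv' : w = v'
  · rw [hwv', hv'_new]
    simp
  · rw [vertexOK_congr_edgeVal G c w (fun u hu => hkeep _ ((SimpleGraph.mem_edgeSet G).mpr hu)
      (fun h => ?_)), hx w]
    · exact ⟨fun _ => hwv', fun _ => hwv⟩
    · rcases Sym2.eq_iff.mp h with ⟨h1, -⟩ | ⟨h1, -⟩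
      · exact hwv h1
      · exact hwv' h1

/-! ### The falsifiers of a linear clause as an affine system on the slots -/

/-- Parity bookkeeping: under `pad x` the number of true variables of a form `f`, mod 2, is the dot
product of the restricted coefficient vector of `f` with the `𝔽₂`-vector of `x`. -/
theorem card_filter_pad_eq_dotProduct (x : Fin (3 * N ^ 2) → Bool) (f : Finset ℕ) :
    (((f.filter fun i => pad x i = true).card : ℕ) : ZMod 2) =
      (fun v : Fin (3 * N ^ 2) => if (v : ℕ) ∈ f then (1 : ZMod 2) else 0) ⬝ᵥ
        (fun v => if x v = true then (1 : ZMod 2) else 0) := by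
  classical
  unfold dotProduct
  have h1 : ∀ v : Fin (3 * N ^ 2),
      (if (v : ℕ) ∈ f then (1 : ZMod 2) else 0) * (if x v = true then (1 : ZMod 2) else 0) =
        if ((v : ℕ) ∈ f ∧ x v = true) then 1 else 0 := by
    intro v
    by_cases ha : (v : ℕ) ∈ f <;> by_cases hb : x v = true <;> simp [ha, hb]
  rw [Finset.sum_congr rfl (fun v _ => h1 v), Finset.sum_boole]
  congr 1
  -- the bijection `v ↦ ↑v` between the two index sets
  have himage : (f.filter fun i => pad x i = true) =
      (Finset.univ.filter fun v : Fin (3 * N ^ 2) => (v : ℕ) ∈ f ∧ x v = true).image Fin.val := by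
    ext i
    simp only [Finset.mem_filter, Finset.mem_image, Finset.mem_univ, true_and]
    constructor
    · rintro ⟨hi, hp⟩
      have hlt : i < 3 * N ^ 2 := by
        by_contra hlt
        unfold pad at hp
        rw [dif_neg hlt] at hp
        exact Bool.false_ne_true hp
      refine ⟨⟨i, hlt⟩, ⟨hi, ?_⟩, rfl⟩
      unfold pad at hp
      rw [dif_pos hlt] at hp
      exact hp
    · rintro ⟨v, ⟨hv, hxv⟩, rfl⟩
      refine ⟨hv, ?_⟩
      unfold pad
      rw [dif_pos v.isLt]
      exact hxv
  rw [himage, Finset.card_image_of_injective _ Fin.val_injective]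

end ResLinBoundaryLaw

end Summit.PneNP.PneNP.Theorems
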